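import Summits.Ventures.CertifiedManyBodySolver.Downfold.EmeryThermalBandSeam
import HarnessLib

/-!
# THE CONVEX-COMBINATION THERMAL CAP: caps at ANY finite family of tilted points bind every point of their convex hull — INCLUDING THE LEVEL DIRECTION
# (the cell pressure is jointly convex in all six line coordinates, so vertex certificates at DIFFERENT tilts combine with NO transfer loss)

Venture CertifiedManyBodySolver, cell `pub/hubbard-downfold` (S1 = ROUTER) × crew hubbard-fast S2 (ii) × (iv) «T > 0 × multi-band»; seat hubbard-downfold-mod-4 (S1/S2 Emery seam).
Namespace `Summit.Ventures.CertifiedManyBodySolver.Downfold`.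

WHY: hubbard-box-p2 g16's device «KLDL-V» certified `CuO₄`-plus kernel floors at ALL 32 vertices of the La₂CuO₄ / Hg-1201 six-boxes (`EmeryBoxes<Obj>VertexFloorsA…H`,
each vertex at its own μ-tilt, each file proving the `PosSemidef` fact `<obj>V_<v>_hq`). Through hubbard-box-p1's R153 every one of them is an exact-tilt `T > 0` cap
(`emeryCellPressure_tiltedCorner_le_of_cuO4Certificate`). The map `q ↦ P_cell(β, emeryLine s q)` is CONVEX on all of `ℝ⁶` (`convexOn_emeryCellPressure_line`) — the
reference level `ε_p = q₃` included — so Jensen's inequality turns caps at finitely many tilted points `vᵢ + μᵢ·(0,0,1,1,0,0)` into a cap at every convex combination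
of them, at the combination's OWN level `Σ wᵢ μᵢ`: no monotone level transfer, no slack beyond the vertex slacks. At the arithmetic mean of the 32 vertices (the box
CENTRE read at the mean tilt) the weights are all `1/32`.

* `emeryCellPressure_line_convexComb_le` — Jensen for the cell pressure along the line: weights `wᵢ ≥ 0`, `Σ wᵢ = 1`, caps `Mᵢ` at `emeryLine s (vᵢ)` ⇒
  `P_cell(β, emeryLine s (Σ wᵢ•vᵢ)) ≤ Σ wᵢ Mᵢ` (any β: convexity needs no sign).
* **`emeryCellPressure_line_convexComb_le_of_tiltedCuO4Certificates`** — the same with the caps supplied by uniform-weight `CuO₄` certificates at the tilted points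
  (mass `M > 0`, multiplier `0`, `β ≥ 0`): `P_cell(β, emeryLine s (Σ wᵢ•(vᵢ + μᵢ·(0,0,1,1,0,0)))) ≤ 6 log 2 + β·Σ wᵢ·(−q₀ᵢ/M)`.

Everything PROVED (0 sorry); no definition. Consumers: `EmeryBoxes<Obj>ThermalCentreWord` (this seat; the 32-vertex means). HONEST FRAMING: a door; the cap keeps the full
entropy `6 log 2` per CuO₂; the points and certificates are the device owner's; no phase word.
-/

noncomputable section

namespace Summit.Ventures.CertifiedManyBodySolver.Downfold

open NonemptyInterval Matrix Finset Literature.Probability.LatticeModels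
open Literature.MathematicalPhysics.QuantumLattice Literature.Computation.Certificates
open Summit.Ventures.CertifiedManyBodySolver.Certificates OccupationCode ClusterLowerBound
open scoped BigOperators ComplexOrder

/-- **Jensen for the cell pressure along the physical line**: weights `wᵢ ≥ 0` with `Σ wᵢ = 1` and caps `P_cell(β, emeryLine s vᵢ) ≤ Mᵢ` give
`P_cell(β, emeryLine s (Σᵢ wᵢ • vᵢ)) ≤ Σᵢ wᵢ·Mᵢ`. [cite: Israel1979, Thm. I.3.4] -/
theorem emeryCellPressure_line_convexComb_le (β : ℝ) (s : Fin 4 → ℝ) {ι : Type*} [Fintype ι]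
    (w : ι → ℝ) (v : ι → Fin 6 → ℝ) (hw0 : ∀ i, 0 ≤ w i) (hw1 : ∑ i, w i = 1) {M : ι → ℝ}
    (hM : ∀ i, emeryCellPressure β (emeryLine s (v i)) ≤ M i) :
    emeryCellPressure β (emeryLine s (∑ i, w i • v i)) ≤ ∑ i, w i * M i := by
  have hJ := (convexOn_emeryCellPressure_line β s).map_sum_le (t := Finset.univ) (p := v) (fun i _ => hw0 i) hw1
    (fun i _ => Set.mem_univ _)
  refine hJ.trans (Finset.sum_le_sum fun i _ => ?_)
  rw [smul_eq_mul]
  exact mul_le_mul_of_nonneg_left (hM i) (hw0 i)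

/-- **THE CONVEX-COMBINATION CAP FROM TILTED `CuO₄` CERTIFICATES.** `β ≥ 0`, mass `M > 0`; at each point `vᵢ` a uniform-weight `CuO₄` window certificate
`H^{w_M}_{W₅}[emeryInteraction (emeryLine s vᵢ + μᵢ·levelDir)] + 0 − q₀ᵢ·1 ⪰ 0` (exactly the `<obj>V_<v>_hq` / `<obj>Floor_hq<i>` facts of the landed vertex and
floor words); weights `wᵢ ≥ 0`, `Σ wᵢ = 1` ⇒ at the convex combination of the TILTED points (its own reference level `Σ wᵢ μᵢ`):
`P_cell(β, emeryLine s (Σ wᵢ•(vᵢ + μᵢ·(0,0,1,1,0,0)))) ≤ 6 log 2 + β·Σ wᵢ·(−q₀ᵢ/M)`. [cite: Israel1979, Thm. I.2.4] [cite: ValentiStolzeHirschfeld1991, §II] -/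
theorem emeryCellPressure_line_convexComb_le_of_tiltedCuO4Certificates {β : ℝ} (hβ : 0 ≤ β) (s : Fin 4 → ℝ) {ι : Type*} [Fintype ι]
    (w : ι → ℝ) (v : ι → Fin 6 → ℝ) (hw0 : ∀ i, 0 ≤ w i) (hw1 : ∑ i, w i = 1) (μ q₀ : ι → ℝ) {M : ℝ} (hM : 0 < M)
    (hq : ∀ i, ((⟨fun X => (uniformPeriodicWeight liebPeriods emeryCuO4Window M X : ℂ) •
        (emeryInteraction (emeryLine s (v i) + μ i • levelDir)).Φ X⟩ : FermionInteraction 2).localHamiltonian emeryCuO4Window +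
        (0 : FermionOp emeryCuO4Window) - (q₀ i : ℂ) • (1 : FermionOp emeryCuO4Window)).PosSemidef) :
    emeryCellPressure β (emeryLine s (∑ i, w i • (v i + μ i • (![0, 0, 1, 1, 0, 0] : Fin 6 → ℝ)))) ≤
      6 * Real.log 2 + β * ∑ i, w i * (-q₀ i / M) := by
  have h := emeryCellPressure_line_convexComb_le β s w (fun i => v i + μ i • (![0, 0, 1, 1, 0, 0] : Fin 6 → ℝ)) hw0 hw1
    (M := fun i => 6 * Real.log 2 + β * (-q₀ i / M)) fun i => by
      rw [emeryLine_add_smul_levelVec]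
      exact emeryCellPressure_tiltedCorner_le_of_cuO4Certificate hβ _ _ hM (fun ω' _ => re_expect_zero_cuO4 ω') (hq i)
  have e : ∀ i, w i * (6 * Real.log 2 + β * (-q₀ i / M)) = 6 * Real.log 2 * w i + β * (w i * (-q₀ i / M)) := fun i => by ring
  simp_rw [e, Finset.sum_add_distrib, ← Finset.mul_sum, hw1, mul_one] at h
  exact h

end Summit.Ventures.CertifiedManyBodySolver.Downfold

end
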